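import Summits.AtomisticToContinuum.FouriersLaw.Theses.BondHeatUncertainty

/-!
# `LinearResponseFTUR` (stmt-AtomisticToContinuum-9122): load-bearing structure of conclusion (b)

Negative / tightness lemmas from the standing disprover of crux (★) `LinearResponseFTUR` of route
`BondHeatUncertainty` (work file `Cruxes/LinearResponseFTUR/Disproof.lean`, §4). Conclusion (b) of the
crux has, at one bond, the real-variable SHAPE

  `∀ t > 0, 2 G² t² ≤ V t · (G t / T² + K)`      (`G = D_N/(N-1)`, `V` = bond-heat variance),

and `linearResponseFTUR_shape` below shows the crux delivers exactly this shape for its own `V`. The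
lemmas record which parts of the shape are load-bearing and that its constants are sharp:

* `not_shape_K_zero`     — the `K`-term is load-bearing: `K = 0`, `G > 0`, `V ≤ c t²` near `0` is
  impossible (the plain finite-time TUR is false for underdamped chains; `K = 2‖h_odd‖²` repairs it);
* `shape_static_bound`   — `t → 0`: `V ≤ c t²` near `0` forces `2G² ≤ c K` (static Cauchy–Schwarz);
* `shape_memory_le`      — `t → ∞`: `V ≤ 2T²G t - 2M` eventually (open-chain Kubo identity
  `∫₀^∞ C_N(b,s) ds = T² G`, `M ≈ ∫₀^∞ s C_N(b,s) ds`) forces `M ≤ K T⁴`; the leading terms cancel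
  EXACTLY, so
* `not_shape_two_add`    — the natural strengthening "constant `2 + ε`" is false under saturation;
* `shape_nonneg`         — (b) ⇒ (a): `G < 0` is incompatible with `V > 0` at late times, so clause (a)
  of the crux only carries weight when no `K` is admissible;
* `shape_eq_zero_of_nonpos` — junk-sensitivity: `V t₀ ≤ 0` at one `t₀ > 0` forces `G = 0`, so provers
  must show the autocorrelation is interval-integrable and the variance positive;
* `linearResponseFTUR_memory_bound` — the memory bound stated on the crux itself.
-/

namespace Summit.AtomisticToContinuum.FouriersLaw.Theorems.LinearResponseFTUR.Negative

open MeasureTheory Filter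
open Literature.MathematicalPhysics.KineticTheory.HeatConduction
open Summit.AtomisticToContinuum.FouriersLaw.Theses.BondHeatUncertainty

/-- **The `K`-term is load-bearing.** With `K = 0`, `G > 0` and an at-most-quadratic variance near
`t = 0` (true: `V(t) = ⟨j_b²⟩t² + O(t³)`), the shape of (b) fails. -/
theorem not_shape_K_zero {G T c t₀ : ℝ} {V : ℝ → ℝ} (hG : 0 < G) (hT : 0 < T) (ht₀ : 0 < t₀)
    (hV : ∀ t, 0 < t → t ≤ t₀ → V t ≤ c * t ^ 2) :
    ¬ ∀ t : ℝ, 0 < t → 2 * G ^ 2 * t ^ 2 ≤ V t * (G * t / T ^ 2 + 0) := by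
  intro h
  set t := min t₀ (G * T ^ 2 / (|c| + 1)) with ht_def
  have hc1 : 0 < |c| + 1 := by positivity
  have htpos : 0 < t := lt_min ht₀ (by positivity)
  have ht1 : t ≤ t₀ := min_le_left _ _
  have ht2 : t ≤ G * T ^ 2 / (|c| + 1) := min_le_right _ _
  have ht2' : t * (|c| + 1) ≤ G * T ^ 2 := by
    have := (le_div_iff₀ hc1).mp ht2; linarith
  have h1 := h t htpos
  have hVt := hV t htpos ht1
  have hT2 : 0 < T ^ 2 := by positivity
  have hfac : 0 ≤ G * t / T ^ 2 + 0 := by positivity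
  have h2 : V t * (G * t / T ^ 2 + 0) ≤ |c| * t ^ 2 * (G * t / T ^ 2 + 0) := by
    apply mul_le_mul_of_nonneg_right _ hfac
    calc V t ≤ c * t ^ 2 := hVt
      _ ≤ |c| * t ^ 2 := by nlinarith [le_abs_self c, sq_nonneg t]
  have h3 : 2 * G ^ 2 * t ^ 2 ≤ |c| * t ^ 2 * (G * t / T ^ 2) := by simpa using h1.trans h2
  have h4 : 2 * G * T ^ 2 ≤ |c| * t := by
    have hpos : 0 < G * t ^ 2 := by positivity
    have : 2 * G ^ 2 * t ^ 2 * T ^ 2 ≤ |c| * t ^ 2 * (G * t) := by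
      have := mul_le_mul_of_nonneg_right h3 hT2.le
      calc 2 * G ^ 2 * t ^ 2 * T ^ 2 ≤ |c| * t ^ 2 * (G * t / T ^ 2) * T ^ 2 := this
        _ = |c| * t ^ 2 * (G * t) := by field_simp
    nlinarith
  nlinarith [abs_nonneg c]

/-- **Static bound (`t → 0`).** If `V t ≤ c t²` near `0` then the shape forces `2G² ≤ c K`
(the Cauchy–Schwarz bound `K ≥ 2G²/⟨j_b²⟩`, consistent with `K_N = 2‖h_odd‖²`). -/
theorem shape_static_bound {G T K c t₀ : ℝ} {V : ℝ → ℝ}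
    (h : ∀ t : ℝ, 0 < t → 2 * G ^ 2 * t ^ 2 ≤ V t * (G * t / T ^ 2 + K)) (hG : 0 ≤ G)
    (hT : 0 < T) (hK : 0 ≤ K) (hc : 0 < c) (ht₀ : 0 < t₀)
    (hV : ∀ t, 0 < t → t ≤ t₀ → V t ≤ c * t ^ 2) :
    2 * G ^ 2 ≤ c * K := by
  by_contra hlt
  push Not at hlt
  set ε := 2 * G ^ 2 - c * K with hε
  have hεpos : 0 < ε := by linarith
  set t := min t₀ (ε * T ^ 2 / (2 * (c * G + 1))) with ht_def
  have hcG : 0 < c * G + 1 := by positivity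
  have htpos : 0 < t := lt_min ht₀ (by positivity)
  have ht1 : t ≤ t₀ := min_le_left _ _
  have ht2 : t ≤ ε * T ^ 2 / (2 * (c * G + 1)) := min_le_right _ _
  have ht2' : t * (2 * (c * G + 1)) ≤ ε * T ^ 2 := (le_div_iff₀ (by positivity)).mp ht2
  have hT2 : 0 < T ^ 2 := by positivity
  have h1 := h t htpos
  have hfac : 0 ≤ G * t / T ^ 2 + K := by positivity
  have h2 : 2 * G ^ 2 * t ^ 2 ≤ c * t ^ 2 * (G * t / T ^ 2 + K) :=
    h1.trans (mul_le_mul_of_nonneg_right (hV t htpos ht1) hfac)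
  have h3 : 2 * G ^ 2 ≤ c * (G * t / T ^ 2 + K) := by
    have ht2pos : 0 < t ^ 2 := by positivity
    nlinarith
  have h4 : ε * T ^ 2 ≤ c * G * t := by
    have : ε ≤ c * G * t / T ^ 2 := by
      have := h3; rw [hε]; ring_nf; ring_nf at this; linarith
    have := (le_div_iff₀ hT2).mp this; linarith
  nlinarith

/-- **Memory bound (`t → ∞`; tightness).** If eventually `V t ≤ 2T²G t - 2M`, then the shape forces
`M ≤ K T⁴`; the leading terms `2G²t²` cancel exactly. For the crux: `K_N ≥ T⁻⁴ ∫₀^∞ s C_N(b,s) ds` at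
every bond. -/
theorem shape_memory_le {G T K M t₁ : ℝ} {V : ℝ → ℝ}
    (h : ∀ t : ℝ, 0 < t → 2 * G ^ 2 * t ^ 2 ≤ V t * (G * t / T ^ 2 + K)) (hG : 0 < G)
    (hT : 0 < T) (hK : 0 ≤ K) (hV : ∀ t, t₁ ≤ t → V t ≤ 2 * T ^ 2 * G * t - 2 * M) :
    M ≤ K * T ^ 4 := by
  by_contra hlt
  push Not at hlt
  set ε := M - K * T ^ 4 with hε
  have hεpos : 0 < ε := by linarith
  have hT2 : 0 < T ^ 2 := by positivity
  set t := max (max t₁ 1) ((|M| * K * T ^ 2 + 1) / (G * ε)) with ht_def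
  have ht1 : t₁ ≤ t := (le_max_left _ _).trans (le_max_left _ _)
  have htpos : 0 < t := lt_of_lt_of_le one_pos ((le_max_right _ _).trans (le_max_left _ _))
  have ht3 : (|M| * K * T ^ 2 + 1) / (G * ε) ≤ t := le_max_right _ _
  have ht3' : |M| * K * T ^ 2 + 1 ≤ t * (G * ε) := (div_le_iff₀ (by positivity)).mp ht3
  have h1 := h t htpos
  have hfac : 0 ≤ G * t / T ^ 2 + K := by positivity
  have h2 : 2 * G ^ 2 * t ^ 2 ≤ (2 * T ^ 2 * G * t - 2 * M) * (G * t / T ^ 2 + K) :=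
    h1.trans (mul_le_mul_of_nonneg_right (hV t ht1) hfac)
  have h3 : 0 ≤ 2 * T ^ 2 * G * K * t - 2 * M * G * t / T ^ 2 - 2 * M * K := by
    have : (2 * T ^ 2 * G * t - 2 * M) * (G * t / T ^ 2 + K)
        = 2 * G ^ 2 * t ^ 2 + (2 * T ^ 2 * G * K * t - 2 * M * G * t / T ^ 2 - 2 * M * K) := by
      field_simp; ring
    linarith [h2, this]
  have h4 : 0 ≤ 2 * T ^ 4 * G * K * t - 2 * M * G * t - 2 * M * K * T ^ 2 := by
    have := mul_nonneg h3 hT2.le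
    have e : (2 * T ^ 2 * G * K * t - 2 * M * G * t / T ^ 2 - 2 * M * K) * T ^ 2
        = 2 * T ^ 4 * G * K * t - 2 * M * G * t - 2 * M * K * T ^ 2 := by
      field_simp
    linarith [this, e]
  have h5 : 2 * G * t * ε ≤ -(2 * M * K * T ^ 2) := by
    have : 2 * T ^ 4 * G * K * t - 2 * M * G * t = -(2 * G * t * ε) := by rw [hε]; ring
    linarith
  have h6 : -(2 * M * K * T ^ 2) ≤ 2 * (|M| * K * T ^ 2) := by
    have := neg_abs_le M
    nlinarith [mul_nonneg hK hT2.le]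
  nlinarith [ht3', h5, h6]

/-- **The constant `2` is sharp (natural strengthening refuted).** Under late-time saturation
`V t ≤ 2T²G t + A`, no inequality `(2+ε) G² t² ≤ V t (G t/T² + K)` holds for all `t > 0`. -/
theorem not_shape_two_add {G T K A t₁ ε : ℝ} {V : ℝ → ℝ} (hG : 0 < G) (hT : 0 < T) (hK : 0 ≤ K)
    (hε : 0 < ε) (hV : ∀ t, t₁ ≤ t → V t ≤ 2 * T ^ 2 * G * t + A) :
    ¬ ∀ t : ℝ, 0 < t → (2 + ε) * G ^ 2 * t ^ 2 ≤ V t * (G * t / T ^ 2 + K) := by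
  intro h
  have hT2 : 0 < T ^ 2 := by positivity
  set c₁ := 2 * T ^ 2 * G * K + |A| * G / T ^ 2 with hc₁
  set c₀ := |A| * K with hc₀
  have hc₁nn : 0 ≤ c₁ := by positivity
  have hc₀nn : 0 ≤ c₀ := by positivity
  set t := max (max t₁ 1) ((c₁ + c₀ + 1) / (ε * G ^ 2)) with ht_def
  have ht1 : t₁ ≤ t := (le_max_left _ _).trans (le_max_left _ _)
  have htone : 1 ≤ t := (le_max_right _ _).trans (le_max_left _ _)
  have htpos : 0 < t := lt_of_lt_of_le one_pos htone
  have ht3 : (c₁ + c₀ + 1) / (ε * G ^ 2) ≤ t := le_max_right _ _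
  have ht3' : c₁ + c₀ + 1 ≤ t * (ε * G ^ 2) := (div_le_iff₀ (by positivity)).mp ht3
  have h1 := h t htpos
  have hfac : 0 ≤ G * t / T ^ 2 + K := by positivity
  have h2 : (2 + ε) * G ^ 2 * t ^ 2 ≤ (2 * T ^ 2 * G * t + A) * (G * t / T ^ 2 + K) :=
    h1.trans (mul_le_mul_of_nonneg_right (hV t ht1) hfac)
  have h3 : (2 * T ^ 2 * G * t + A) * (G * t / T ^ 2 + K)
      = 2 * G ^ 2 * t ^ 2 + (2 * T ^ 2 * G * K + A * G / T ^ 2) * t + A * K := by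
    field_simp; ring
  have h4 : ε * G ^ 2 * t ^ 2 ≤ (2 * T ^ 2 * G * K + A * G / T ^ 2) * t + A * K := by
    nlinarith [h2, h3]
  have h5 : (2 * T ^ 2 * G * K + A * G / T ^ 2) * t + A * K ≤ c₁ * t + c₀ := by
    have hA := le_abs_self A
    have : A * G / T ^ 2 ≤ |A| * G / T ^ 2 :=
      div_le_div_of_nonneg_right (mul_le_mul_of_nonneg_right hA hG.le) hT2.le
    nlinarith [mul_le_mul_of_nonneg_right hA hK]
  have h6 : c₁ * t + c₀ ≤ (c₁ + c₀) * t := by nlinarith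
  nlinarith [h4, h5, h6, ht3', htpos]

/-- **(b) ⇒ (a).** If the variance is positive at arbitrarily late times (it is `~ 2T²G t`), the shape
alone forces `G ≥ 0`. -/
theorem shape_nonneg {G T K : ℝ} {V : ℝ → ℝ}
    (h : ∀ t : ℝ, 0 < t → 2 * G ^ 2 * t ^ 2 ≤ V t * (G * t / T ^ 2 + K)) (hT : 0 < T)
    (hV : ∀ t₀ : ℝ, ∃ t, t₀ ≤ t ∧ 0 < V t) : 0 ≤ G := by
  by_contra hG
  push Not at hG
  have hT2 : 0 < T ^ 2 := by positivity
  obtain ⟨t, ht, hVt⟩ := hV (max 1 ((K + 1) * T ^ 2 / (-G)))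
  have htpos : 0 < t := lt_of_lt_of_le one_pos ((le_max_left _ _).trans ht)
  have ht2 : (K + 1) * T ^ 2 / (-G) ≤ t := (le_max_right _ _).trans ht
  have ht2' : (K + 1) * T ^ 2 ≤ t * (-G) := (div_le_iff₀ (by linarith)).mp ht2
  have hfac : G * t / T ^ 2 + K ≤ -1 := by
    have : G * t ≤ -((K + 1) * T ^ 2) := by linarith
    have : G * t / T ^ 2 ≤ -(K + 1) := by
      rw [div_le_iff₀ hT2]; linarith
    linarith
  have h1 := h t htpos
  have : V t * (G * t / T ^ 2 + K) ≤ V t * (-1) := mul_le_mul_of_nonneg_left hfac hVt.le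
  nlinarith [sq_nonneg (G * t)]

/-- **Junk-sensitivity.** `V t₀ ≤ 0` at one `t₀ > 0` (e.g. a Bochner/interval integral returning `0` on a
non-integrable autocorrelation) forces `G = 0` given `G ≥ 0` from (a). -/
theorem shape_eq_zero_of_nonpos {G T K t₀ : ℝ} {V : ℝ → ℝ}
    (h : ∀ t : ℝ, 0 < t → 2 * G ^ 2 * t ^ 2 ≤ V t * (G * t / T ^ 2 + K)) (hG : 0 ≤ G)
    (hT : 0 < T) (hK : 0 ≤ K) (ht₀ : 0 < t₀) (hV : V t₀ ≤ 0) : G = 0 := by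
  have h1 := h t₀ ht₀
  have hfac : 0 ≤ G * t₀ / T ^ 2 + K := by positivity
  have h2 : V t₀ * (G * t₀ / T ^ 2 + K) ≤ 0 := mul_nonpos_of_nonpos_of_nonneg hV hfac
  have h3 : G ^ 2 * t₀ ^ 2 ≤ 0 := by linarith
  have h4 : G ^ 2 * t₀ ^ 2 = 0 := le_antisymm h3 (by positivity)
  have : G ^ 2 = 0 := by
    rcases mul_eq_zero.mp h4 with h | h
    · exact h
    · exact absurd h (by positivity)
  exact pow_eq_zero_iff (n := 2) (by norm_num) |>.mp this

/-- **LINK.** `LinearResponseFTUR` delivers, at each bond and each admissible `K`, exactly the shape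
above for the crux's own bond-heat variance `t ↦ 2∫₀ᵗ (t-s) C_N(b,s) ds` (so the six lemmas are
statements about the crux), together with clause (a). -/
theorem linearResponseFTUR_shape (h : LinearResponseFTUR) {ω₂ lam β γ : ℝ} (hω : 0 < ω₂)
    (hl : 0 < lam) (hβ : 0 < β) (hγ : 0 < γ)
    (huniq : ∀ (N : ℕ) (T_L T_R : ℝ), 0 < T_L → 0 < T_R → ∀ μ ν : Measure (PhaseSpace N),
      (pinnedChain ω₂ lam β γ).IsSteadyState N T_L T_R μ →
      (pinnedChain ω₂ lam β γ).IsSteadyState N T_L T_R ν → μ = ν)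
    (μ : (N : ℕ) → ℝ → ℝ → Measure (PhaseSpace N))
    (hμ : ∀ (N : ℕ) (T_L T_R : ℝ), 0 < T_L → 0 < T_R →
      (pinnedChain ω₂ lam β γ).IsSteadyState N T_L T_R (μ N T_L T_R))
    {T : ℝ} (hT : 0 < T) (D : ℕ → ℝ)
    (hD : ∀ N : ℕ, Tendsto (fun δ : ℝ =>
      (pinnedChain ω₂ lam β γ).totalCurrent (μ N (T + δ / 2) (T - δ / 2)) / δ)
      (nhdsWithin 0 {(0 : ℝ)}ᶜ) (nhds (D N)))
    {N : ℕ} (hN : 2 ≤ N) {b : ℕ} (hb : b + 1 < N) {K : ℝ} (hK : 0 ≤ K)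
    (hKL : ∀ᶠ δ in nhdsWithin (0 : ℝ) {(0 : ℝ)}ᶜ,
      InformationTheory.klDiv (μ N (T + δ / 2) (T - δ / 2))
        (Measure.map (fun x : PhaseSpace N => (x.1, -x.2)) (μ N (T + δ / 2) (T - δ / 2)))
        ≤ ENNReal.ofReal (K * δ ^ 2)) :
    0 ≤ D N ∧ ∀ t : ℝ, 0 < t →
      2 * (D N / ((N : ℝ) - 1)) ^ 2 * t ^ 2 ≤
        (2 * ∫ s in (0 : ℝ)..t, (t - s) *
          (if h : b < N then
            ∫ z, (pinnedChain ω₂ lam β γ).bondCurrent N ⟨b, h⟩ z *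
                (∫ y, (pinnedChain ω₂ lam β γ).bondCurrent N ⟨b, h⟩ y
                  ∂((pinnedChain ω₂ lam β γ).transitionKernel N T T s.toNNReal z))
              ∂((pinnedChain ω₂ lam β γ).gibbsMeasure N T)
          else 0)) * (D N / ((N : ℝ) - 1) * t / T ^ 2 + K) := by
  have h' := h ω₂ lam β γ hω hl hβ hγ huniq μ hμ T hT D hD N hN
  exact ⟨h'.1, fun t ht => h'.2 b hb t ht K hK hKL⟩

/-- **Memory bound stated on the crux.** Under `LinearResponseFTUR`, late-time saturation of the crux's
bond-heat variance, `V_N(b,t) ≤ 2T²G t - 2M` for `t ≥ t₁` (`G = D N/(N-1) > 0`), forces `M ≤ K T⁴` for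
every admissible `K`: the crux predicts `lim sup δ⁻² KL(μ_δ‖Θ_*μ_δ) ≥ T⁻⁴ ∫₀^∞ s C_N(b,s) ds`. -/
theorem linearResponseFTUR_memory_bound (h : LinearResponseFTUR) {ω₂ lam β γ : ℝ} (hω : 0 < ω₂)
    (hl : 0 < lam) (hβ : 0 < β) (hγ : 0 < γ)
    (huniq : ∀ (N : ℕ) (T_L T_R : ℝ), 0 < T_L → 0 < T_R → ∀ μ ν : Measure (PhaseSpace N),
      (pinnedChain ω₂ lam β γ).IsSteadyState N T_L T_R μ →
      (pinnedChain ω₂ lam β γ).IsSteadyState N T_L T_R ν → μ = ν)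
    (μ : (N : ℕ) → ℝ → ℝ → Measure (PhaseSpace N))
    (hμ : ∀ (N : ℕ) (T_L T_R : ℝ), 0 < T_L → 0 < T_R →
      (pinnedChain ω₂ lam β γ).IsSteadyState N T_L T_R (μ N T_L T_R))
    {T : ℝ} (hT : 0 < T) (D : ℕ → ℝ)
    (hD : ∀ N : ℕ, Tendsto (fun δ : ℝ =>
      (pinnedChain ω₂ lam β γ).totalCurrent (μ N (T + δ / 2) (T - δ / 2)) / δ)
      (nhdsWithin 0 {(0 : ℝ)}ᶜ) (nhds (D N)))
    {N : ℕ} (hN : 2 ≤ N) (hDpos : 0 < D N) {b : ℕ} (hb : b + 1 < N) {K : ℝ} (hK : 0 ≤ K)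
    (hKL : ∀ᶠ δ in nhdsWithin (0 : ℝ) {(0 : ℝ)}ᶜ,
      InformationTheory.klDiv (μ N (T + δ / 2) (T - δ / 2))
        (Measure.map (fun x : PhaseSpace N => (x.1, -x.2)) (μ N (T + δ / 2) (T - δ / 2)))
        ≤ ENNReal.ofReal (K * δ ^ 2))
    {M t₁ : ℝ}
    (hV : ∀ t, t₁ ≤ t →
      (2 * ∫ s in (0 : ℝ)..t, (t - s) *
          (if h : b < N then
            ∫ z, (pinnedChain ω₂ lam β γ).bondCurrent N ⟨b, h⟩ z *
                (∫ y, (pinnedChain ω₂ lam β γ).bondCurrent N ⟨b, h⟩ y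
                  ∂((pinnedChain ω₂ lam β γ).transitionKernel N T T s.toNNReal z))
              ∂((pinnedChain ω₂ lam β γ).gibbsMeasure N T)
          else 0)) ≤ 2 * T ^ 2 * (D N / ((N : ℝ) - 1)) * t - 2 * M) :
    M ≤ K * T ^ 4 := by
  have hs := (linearResponseFTUR_shape h hω hl hβ hγ huniq μ hμ hT D hD hN hb hK hKL).2
  have hG : 0 < D N / ((N : ℝ) - 1) := by
    have : (2 : ℝ) ≤ N := by exact_mod_cast hN
    exact div_pos hDpos (by linarith)
  exact shape_memory_le hs hG hT hK hV

end Summit.AtomisticToContinuum.FouriersLaw.Theorems.LinearResponseFTUR.Negative
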